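import Summits.BirchSwinnertonDyer.BirchSwinnertonDyer.Theorems.ResidualThetaTransportAtTwoPollackPairKUnique
import Summits.BirchSwinnertonDyer.BirchSwinnertonDyer.Theorems.ResidualThetaTransportAtTwoDefs
import HarnessLib

/-!
# The VALUES RELAY of the `(i)`-half (H11) in Λ-MULTIPLIER form: «Mazur–Tate-currency reciprocity for the trivialised column» (MTV_ρ, with a
# power-series multiplier `μt ∈ Λ_𝒪`) ⟹ `hERL` (`∃ ν D u ≠ 0, C ν · e (π.cvec z) = D·(L⁻·u)` with `D := μt`) — Coleman half PROVED over the one-pair pins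

Route `ResidualThetaTransportAtTwo` (RTT), crux RSL_g `ResidualSignedLambdaLowerCMAtTwo` (stmt-BirchSwinnertonDyer-22608), hold KZ_g
`KatoZetaCMFormAtTwoSupply` (stmt-BirchSwinnertonDyer-24105). Width seat `prover-bsd-wall-tp2-p2x-w2` g21 (`--supports 22608 --as helper`, closes
nothing). THEOREMS ONLY (no `def`, no named fact, no instance, no `sorry`); BSD is NOT proved by any of this; 22608 / 26074 / 24105 stay OPEN / HOLD.
PORT of the kernel-checked sketch `Cruxes/ResidualThetaCountLowerPureAtTwo/Sketch_sidea_k2_g20.lean` (stub-ideation k2 g20; STUB-PLAN rev 26 row 77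
«H11 relay: MTV_ρ ⟹ hERL PROVED») in the Λ-MULTIPLIER FORM L2 booked by the stub-critic (STUB-PLAN rev 26.6 S136 / Q131: the multiplier of
Kato's §15 valued classes is a power series `μt ∈ Λ_𝒪` — the auxiliary-`𝔞` twist (15.6.3) — not a constant `C μ`; the consumer's `D` absorbs `μt`).
Credit: stub-ideation k2 g20 (the station and every proof idea), k3 g19 (the `hERL` binder of `price_of_parts`), k1 g25 (the Λ-multiplier finding).

TYPING REMARK (why L2 is not a token substitution). The tree's `IsCongrModOmegaO S n θ L` types `θ` as a POLYNOMIAL over `ℚ̄_p`; `ι_Λ μt · θ`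
is a power series, so the Λ-multiplied Mazur–Tate congruence cannot sit in the `θ`-slot. This file therefore states MTV_Λ UNFOLDED, with the same
shape as `IsCongrModOmegaO` but a power-series left member —
`∃ k q, C (p^k) · (ι_Λ μt · ↑θ_{2m}^ι − ι_Λ L) = ↑ω_{2m} · ι_Λ q` — and re-proves the rigidity step of
`PollackPairK.dvd_sub_of_isCongrModOmegaO` for a power-series left member (`dvd_sub_of_congr_powerSeries`; `θ` cancels, its polynomiality is never used).

THE RELAY: print ─K-α→ **MTV_Λ** `μt·θ_{2m}(g)^ι ≡ ν·w·e(P⃗_{2m}(z)) (mod ω_{2m})` (the Mazur–Tate currency in which the tree DEFINES `L⁻_g`,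
`IsPollackPairK`) ─K-β (PROVED)→ `C ν · w · e(𝒸 z) = μt · L⁻_g` ─K-γ (PROVED)→ H11 with `D := μt`, `u := w⁻¹`.
* §1 unfolded-congruence algebra: `congr_mul_of_isCongrModOmegaO`, `congr_of_dvd_sub`, `dvd_sub_of_congr_powerSeries` (rigidity, power-series left member).
* §2 K-β **`C_mul_mul_eq_mul_of_congruences`** (column congruences + MTV_Λ + `IsPollackPairK` ⟹ `C ν·w·E = μt·L⁻`); K-γ `C_mul_eq_mul_mul_inv_of_congruences`.
* §3 the pins: **`hERL_of_mazurTateValues`** — for `π : OnePairPins (range ι) …`, `z ∈ 𝐇¹`, a `Λ`-semilinear `e`, and MTV_Λ for EVERY Honda datum admitted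
  by `π.hcol`: `∃ ν ≠ 0, D ≠ 0, u ≠ 0, C ν · e (π.cvec z) = D·(L⁻·u)` with `D = μt`. §4 frame lemma: `symm_frame_mul`, `symm_frame_eq_mul`.
References: [Kato2004Asterisque] Thm. 12.5 (1)(2), §15.16, (15.6.3); [Kobayashi2003] Thm. 6.2, (8.23), Prop. 8.25, Lem. 8.26; [Pollack2003] Thm. 5.1, Prop. 6.18.
-/

set_option autoImplicit false
-- D-0017: single-problem summit, so `Summit.BirchSwinnertonDyer.BirchSwinnertonDyer.…` repeats a namespace BY DESIGN.
set_option linter.dupNamespace false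

noncomputable section

open scoped Classical Polynomial

namespace Summit.BirchSwinnertonDyer.BirchSwinnertonDyer.Theorems.ThetaTransport.MazurTateValuesRelay

open Polynomial (X C)
open Literature.NumberTheory.EllipticCurves Literature.NumberTheory.EllipticCurves.ModularForms CongruenceSubgroup
  Literature.NumberTheory.Automorphic
  Summit.BirchSwinnertonDyer.BirchSwinnertonDyer.Theorems.PollackPairK

/-! ## §1 Unfolded congruences `C(p^k)·(Θ − ι_Λ L) = ↑ω_n · ι_Λ q` with a POWER-SERIES left member `Θ` -/

section CongrAlgebra

variable {p : ℕ} [hp : Fact p.Prime] {S : Set (PadicAlgCl p)}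

/-- **Multiplying a Pollack congruence by a Λ-multiplier.** If `θ ≡ P·L (mod ω_n)` in `Λ_𝒪 ⊗ ℚ` (`IsCongrModOmegaO`) then, for every
`μt ∈ Λ_𝒪`, `ι_Λ μt · θ ≡ P · ι_Λ (μt · L) (mod ω_n)` in the unfolded power-series form (same power of `p`; witness `μt · q`).
[cite: Pollack2003, Prop. 6.18 (shape of the congruences)] -/
theorem congr_mul_of_isCongrModOmegaO {n : ℕ} {θ : (PadicAlgCl p)[X]} {P : PowerSeries (PadicAlgCl p)} {L : IwasawaAlgebraO S}
    (h : IsCongrModOmegaO S n θ (P * iwasawaOToPowerSeries S L)) (μt : IwasawaAlgebraO S) :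
    ∃ (m : ℕ) (q : IwasawaAlgebraO S),
      PowerSeries.C ((p : PadicAlgCl p) ^ m) *
          (iwasawaOToPowerSeries S μt * (θ : PowerSeries (PadicAlgCl p)) - P * iwasawaOToPowerSeries S (μt * L)) =
        (((cyclotomicOmega p n).map (Int.castRingHom (PadicAlgCl p)) : (PadicAlgCl p)[X]) : PowerSeries (PadicAlgCl p)) *
          iwasawaOToPowerSeries S q := by
  obtain ⟨m, q, e⟩ := h
  refine ⟨m, μt * q, ?_⟩
  rw [map_mul, map_mul]
  linear_combination (iwasawaOToPowerSeries S μt) * e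

/-- **Moving the right member by an integral multiple of `ω_n`** (unfolded form): if `Θ ≡ L₁ (mod ω_n)` and `ω_n ∣ L₁ − L₂` in `Λ_𝒪`, then
`Θ ≡ L₂ (mod ω_n)` (same power of `p`). [cite: Pollack2003, Prop. 6.18 (shape of the congruences)] -/
theorem congr_of_dvd_sub {n : ℕ} {Θ : PowerSeries (PadicAlgCl p)} {L₁ L₂ : IwasawaAlgebraO S}
    (h : ∃ (m : ℕ) (q : IwasawaAlgebraO S),
      PowerSeries.C ((p : PadicAlgCl p) ^ m) * (Θ - iwasawaOToPowerSeries S L₁) =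
        (((cyclotomicOmega p n).map (Int.castRingHom (PadicAlgCl p)) : (PadicAlgCl p)[X]) : PowerSeries (PadicAlgCl p)) *
          iwasawaOToPowerSeries S q)
    (hd : (((cyclotomicOmega p n).map (Int.castRingHom (padicCoeffIntegers S)) : (padicCoeffIntegers S)[X]) :
        IwasawaAlgebraO S) ∣ L₁ - L₂) :
    ∃ (m : ℕ) (q : IwasawaAlgebraO S),
      PowerSeries.C ((p : PadicAlgCl p) ^ m) * (Θ - iwasawaOToPowerSeries S L₂) =
        (((cyclotomicOmega p n).map (Int.castRingHom (PadicAlgCl p)) : (PadicAlgCl p)[X]) : PowerSeries (PadicAlgCl p)) *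
          iwasawaOToPowerSeries S q := by
  obtain ⟨m, q, e⟩ := h
  obtain ⟨r, hr⟩ := hd
  refine ⟨m, q + PowerSeries.C (((p : ℕ) : padicCoeffIntegers S) ^ m) * r, ?_⟩
  have hr' := congr_arg (iwasawaOToPowerSeries S) hr
  rw [map_sub, map_mul, iwasawaOToPowerSeries_coe_map] at hr'
  rw [map_add, map_mul, iwasawaOToPowerSeries_C_natCast_pow]
  linear_combination e + PowerSeries.C ((p : PadicAlgCl p) ^ m) * hr'

/-- **Rigidity for a power-series left member (Steps 1–3 of `PollackPairK.dvd_sub_of_isCongrModOmegaO`, `θ`-slot generalised).** If `L₁, L₂`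
both solve `Θ ≡ c·ω'·L (mod ω_n)` (unfolded, `Θ` ANY power series over `ℚ̄_p`) with `c = ±1`, `ω_n = D·ω'`, `D` and `ω'` monic, then
`D ∣ L₂ − L₁` in `𝒪⟦T⟧`: subtract (injectivity of `𝒪⟦T⟧ → ℚ̄_p⟦T⟧`, `Θ` cancels), cancel `ω'` in the domain, then the constant `p^N` against `D`
(whose reduction modulo `𝔪` is `T^{deg D} ≠ 0`). [cite: Pollack2003, Prop. 6.18 (shape of the congruences)] -/
theorem dvd_sub_of_congr_powerSeries [FiniteDimensional ℚ_[p] (padicCoeffField S)] {n : ℕ} {Θ : PowerSeries (PadicAlgCl p)}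
    {c D ω' : ℤ[X]} (hc : c = 1 ∨ c = -1) (hD : D.Monic) (hω' : ω'.Monic) (hfac : cyclotomicOmega p n = D * ω')
    {L₁ L₂ : IwasawaAlgebraO S}
    (h₁ : ∃ (m : ℕ) (q : IwasawaAlgebraO S),
      PowerSeries.C ((p : PadicAlgCl p) ^ m) * (Θ -
          (((c * ω').map (Int.castRingHom (PadicAlgCl p)) : (PadicAlgCl p)[X]) : PowerSeries (PadicAlgCl p)) * iwasawaOToPowerSeries S L₁) =
        (((cyclotomicOmega p n).map (Int.castRingHom (PadicAlgCl p)) : (PadicAlgCl p)[X]) : PowerSeries (PadicAlgCl p)) *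
          iwasawaOToPowerSeries S q)
    (h₂ : ∃ (m : ℕ) (q : IwasawaAlgebraO S),
      PowerSeries.C ((p : PadicAlgCl p) ^ m) * (Θ -
          (((c * ω').map (Int.castRingHom (PadicAlgCl p)) : (PadicAlgCl p)[X]) : PowerSeries (PadicAlgCl p)) * iwasawaOToPowerSeries S L₂) =
        (((cyclotomicOmega p n).map (Int.castRingHom (PadicAlgCl p)) : (PadicAlgCl p)[X]) : PowerSeries (PadicAlgCl p)) *
          iwasawaOToPowerSeries S q) :
    ((D.map (Int.castRingHom (padicCoeffIntegers S)) : (padicCoeffIntegers S)[X]) : IwasawaAlgebraO S) ∣ L₂ - L₁ := by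
  haveI : IsDiscreteValuationRing (padicCoeffIntegers S) := isDiscreteValuationRing_padicCoeffIntegers
  haveI : CharP (IsLocalRing.ResidueField (padicCoeffIntegers S)) p := charP_residueField_padicCoeffIntegers
  -- Step 1: the integral difference `p^N · (c ω') · (L₂ − L₁) ∈ ω_n 𝒪⟦T⟧` (`Θ` cancels)
  obtain ⟨m₁, q₁, e₁⟩ := h₁
  obtain ⟨m₂, q₂, e₂⟩ := h₂
  have hr : PowerSeries.C (((p : ℕ) : padicCoeffIntegers S) ^ (m₁ + m₂)) *
      ((((c * ω').map (Int.castRingHom (padicCoeffIntegers S)) : (padicCoeffIntegers S)[X]) : IwasawaAlgebraO S) * (L₂ - L₁)) =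
      (((cyclotomicOmega p n).map (Int.castRingHom (padicCoeffIntegers S)) : (padicCoeffIntegers S)[X]) : IwasawaAlgebraO S) *
        (PowerSeries.C (((p : ℕ) : padicCoeffIntegers S) ^ m₂) * q₁ - PowerSeries.C (((p : ℕ) : padicCoeffIntegers S) ^ m₁) * q₂) := by
    apply iwasawaOToPowerSeries_injective S
    rw [map_mul, map_mul, map_sub, iwasawaOToPowerSeries_C_natCast_pow, iwasawaOToPowerSeries_coe_map, map_mul,
      iwasawaOToPowerSeries_coe_map, map_sub, map_mul, map_mul, iwasawaOToPowerSeries_C_natCast_pow,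
      iwasawaOToPowerSeries_C_natCast_pow, pow_add, map_mul]
    linear_combination (PowerSeries.C ((p : PadicAlgCl p) ^ m₂)) * e₁ - (PowerSeries.C ((p : PadicAlgCl p) ^ m₁)) * e₂
  -- Steps 2–3: cancel `ω'`, absorb the sign, peel off `p^N` against `D`
  set N := m₁ + m₂ with hN
  set r := PowerSeries.C (((p : ℕ) : padicCoeffIntegers S) ^ m₂) * q₁ - PowerSeries.C (((p : ℕ) : padicCoeffIntegers S) ^ m₁) * q₂ with hrdef
  set Dₒ : IwasawaAlgebraO S := (↑(D.map (Int.castRingHom (padicCoeffIntegers S))) : IwasawaAlgebraO S) with hDₒ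
  set ωₒ : IwasawaAlgebraO S := (↑(ω'.map (Int.castRingHom (padicCoeffIntegers S))) : IwasawaAlgebraO S) with hωₒ
  set cₒ : IwasawaAlgebraO S := (↑(c.map (Int.castRingHom (padicCoeffIntegers S))) : IwasawaAlgebraO S) with hcₒ
  set π : IwasawaAlgebraO S := PowerSeries.C (((p : ℕ) : padicCoeffIntegers S) ^ N) with hπ
  have hcu : cₒ * cₒ = 1 := by
    rcases hc with rfl | rfl <;> simp [hcₒ]
  have hωne : ωₒ ≠ 0 := by
    rw [hωₒ, Ne, Polynomial.coe_eq_zero_iff]; exact (hω'.map _).ne_zero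
  have e1 : (((c * ω').map (Int.castRingHom (padicCoeffIntegers S)) : (padicCoeffIntegers S)[X]) : IwasawaAlgebraO S) =
      cₒ * ωₒ := by
    rw [Polynomial.map_mul, Polynomial.coe_mul]
  have e2 : (((cyclotomicOmega p n).map (Int.castRingHom (padicCoeffIntegers S)) : (padicCoeffIntegers S)[X]) :
      IwasawaAlgebraO S) = Dₒ * ωₒ := by
    rw [hfac, Polynomial.map_mul, Polynomial.coe_mul]
  rw [e1, e2] at hr
  have h1 : ωₒ * (π * (cₒ * (L₂ - L₁))) = ωₒ * (Dₒ * r) := by linear_combination hr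
  have h2 := mul_left_cancel₀ hωne h1
  have h3 : π * (L₂ - L₁) = Dₒ * (cₒ * r) := by
    linear_combination cₒ * h2 - (π * (L₂ - L₁)) * hcu
  have hDred : PowerSeries.map (IsLocalRing.residue (padicCoeffIntegers S)) Dₒ ≠ 0 := by
    rw [hDₒ, map_residue_coe_eq_X_pow p hD ⟨ω', hfac⟩]; exact pow_ne_zero _ PowerSeries.X_ne_zero
  exact exists_eq_mul_of_C_mul_eq_mul_of_ne_zero (natCast_pow_ne_zero_padicCoeffIntegers N) hDred h3

end CongrAlgebra

/-! ## §2 K-β in Λ-multiplier form: column congruences + MTV_Λ + the Pollack pair ⟹ `C ν · w · E = μt · L⁻` -/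

section Relay

variable {p : ℕ} [hp : Fact p.Prime] {M : ℕ} {g : CuspForm (Gamma0 M) 2} {ι : coeffField g →+* PadicAlgCl p} {Ω : ℂ}

/-- **K-β, Λ-multiplier form (PROVED).** Let `(L⁺, L⁻)` be an `𝒪`-Pollack pair of `g` along `ι`. Let `E ∈ Λ_𝒪` (the trivialised plus-Coleman
column `e(𝒸 z)`) and `Q_m ∈ Λ_𝒪` (the trivialised pairing-sum polynomials `e(P⃗_{2m}(z))`) satisfy the COLUMN CONGRUENCES
`ω_{2m} ∣ Q_m + (−1)^m ω⁻_{2m} E` (the pin `π.hcol` (5) pushed through `e`), and let MTV_Λ hold: `μt·θ_{2m}(g)^ι ≡ ν·w·Q_m (mod ω_{2m})` in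
`Λ_𝒪 ⊗ ℚ` (unfolded, power-series left member) for all `m`, with a MULTIPLIER `μt ∈ Λ_𝒪`. Then `C ν · w · E = μt · L⁻`: both `ν w E` and
`μt L⁻` solve `μt θ_{2m} ≡ (−1)^{m+1}ω⁻_{2m}·(·) (mod ω_{2m})`, so `T ω⁺_{2m}` divides their difference integrally for every `m`, and
`⋂_m (T ω⁺_{2m}) = 0`. [cite: Pollack2003, Thm. 5.1 and Prop. 6.18] [cite: Kobayashi2003, Thm. 6.2 and Prop. 8.25 (pp. 18–23)]
[cite: Kato2004Asterisque, Thm. 12.5 (1) (p. 221), (15.6.3) (p. 254)] -/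
theorem C_mul_mul_eq_mul_of_congruences [FiniteDimensional ℚ_[p] (padicCoeffField (Set.range ι))]
    {Lp Lm : IwasawaAlgebraO (Set.range ι)} (hL : IsPollackPairK g ι Ω Lp Lm)
    (E : IwasawaAlgebraO (Set.range ι)) (Q : ℕ → IwasawaAlgebraO (Set.range ι))
    (μt : IwasawaAlgebraO (Set.range ι)) (ν : padicCoeffIntegers (Set.range ι)) (w : IwasawaAlgebraO (Set.range ι))
    (hcol : ∀ m : ℕ, (((cyclotomicOmega p (2 * m)).map (Int.castRingHom (padicCoeffIntegers (Set.range ι))) :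
        (padicCoeffIntegers (Set.range ι))[X]) : IwasawaAlgebraO (Set.range ι)) ∣
      Q m + ((((-1) ^ m * cyclotomicOmegaMinus p (2 * m)).map (Int.castRingHom (padicCoeffIntegers (Set.range ι))) :
        (padicCoeffIntegers (Set.range ι))[X]) : IwasawaAlgebraO (Set.range ι)) * E)
    (hMT : ∀ m : ℕ, ∃ (k : ℕ) (q : IwasawaAlgebraO (Set.range ι)),
      PowerSeries.C ((p : PadicAlgCl p) ^ k) *
          (iwasawaOToPowerSeries (Set.range ι) μt * (((mazurTateElementK g Ω p (2 * m)).map ι : (PadicAlgCl p)[X]) : PowerSeries (PadicAlgCl p)) -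
            iwasawaOToPowerSeries (Set.range ι) (PowerSeries.C ν * w * Q m)) =
        (((cyclotomicOmega p (2 * m)).map (Int.castRingHom (PadicAlgCl p)) : (PadicAlgCl p)[X]) : PowerSeries (PadicAlgCl p)) *
          iwasawaOToPowerSeries (Set.range ι) q) :
    PowerSeries.C ν * w * E = μt * Lm := by
  haveI : IsDiscreteValuationRing (padicCoeffIntegers (Set.range ι)) := isDiscreteValuationRing_padicCoeffIntegers
  haveI : CharP (IsLocalRing.ResidueField (padicCoeffIntegers (Set.range ι))) p := charP_residueField_padicCoeffIntegers
  have hsign : ∀ n : ℕ, ((-1 : ℤ[X]) ^ (n / 2 + 1)) = 1 ∨ ((-1 : ℤ[X]) ^ (n / 2 + 1)) = -1 :=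
    fun n ↦ neg_one_pow_eq_or ℤ[X] (n / 2 + 1)
  obtain ⟨-, -, -, heven⟩ := hL
  -- (c) multiplied by `μt`: `μt θ_{2m} ≡ ((-1)^{m+1} ω⁻_{2m}) · (μt L⁻)`
  have h₁ : ∀ m : ℕ, ∃ (k : ℕ) (q : IwasawaAlgebraO (Set.range ι)),
      PowerSeries.C ((p : PadicAlgCl p) ^ k) *
          (iwasawaOToPowerSeries (Set.range ι) μt * (((mazurTateElementK g Ω p (2 * m)).map ι : (PadicAlgCl p)[X]) : PowerSeries (PadicAlgCl p)) -
            (((((-1) ^ (2 * m / 2 + 1) * cyclotomicOmegaMinus p (2 * m)).map (Int.castRingHom (PadicAlgCl p)) :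
              (PadicAlgCl p)[X]) : PowerSeries (PadicAlgCl p)) * iwasawaOToPowerSeries (Set.range ι) (μt * Lm))) =
        (((cyclotomicOmega p (2 * m)).map (Int.castRingHom (PadicAlgCl p)) : (PadicAlgCl p)[X]) : PowerSeries (PadicAlgCl p)) *
          iwasawaOToPowerSeries (Set.range ι) q :=
    fun m ↦ congr_mul_of_isCongrModOmegaO (heven (2 * m) ⟨m, two_mul m⟩) μt
  -- (a)+(b): `μt θ_{2m} ≡ ν w Q_m ≡ ((-1)^{m+1} ω⁻_{2m}) · (ν w E)` — the second step is an INTEGRAL congruence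
  have h₂ : ∀ m : ℕ, ∃ (k : ℕ) (q : IwasawaAlgebraO (Set.range ι)),
      PowerSeries.C ((p : PadicAlgCl p) ^ k) *
          (iwasawaOToPowerSeries (Set.range ι) μt * (((mazurTateElementK g Ω p (2 * m)).map ι : (PadicAlgCl p)[X]) : PowerSeries (PadicAlgCl p)) -
            (((((-1) ^ (2 * m / 2 + 1) * cyclotomicOmegaMinus p (2 * m)).map (Int.castRingHom (PadicAlgCl p)) :
              (PadicAlgCl p)[X]) : PowerSeries (PadicAlgCl p)) * iwasawaOToPowerSeries (Set.range ι) (PowerSeries.C ν * w * E))) =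
        (((cyclotomicOmega p (2 * m)).map (Int.castRingHom (PadicAlgCl p)) : (PadicAlgCl p)[X]) : PowerSeries (PadicAlgCl p)) *
          iwasawaOToPowerSeries (Set.range ι) q := by
    intro m
    have hc : ((-1 : ℤ[X]) ^ (2 * m / 2 + 1) * cyclotomicOmegaMinus p (2 * m)) =
        -((-1) ^ m * cyclotomicOmegaMinus p (2 * m)) := by
      rw [Nat.mul_div_cancel_left m two_pos, pow_succ]; ring
    have key := congr_of_dvd_sub (hMT m)
      (L₂ := ((((-1) ^ (2 * m / 2 + 1) * cyclotomicOmegaMinus p (2 * m)).map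
          (Int.castRingHom (padicCoeffIntegers (Set.range ι))) : (padicCoeffIntegers (Set.range ι))[X]) :
            IwasawaAlgebraO (Set.range ι)) * (PowerSeries.C ν * w * E))
      (by
        obtain ⟨r, hr⟩ := hcol m
        refine ⟨PowerSeries.C ν * w * r, ?_⟩
        rw [hc, Polynomial.map_neg, Polynomial.coe_neg]
        linear_combination (PowerSeries.C ν * w) * hr)
    simpa only [map_mul, iwasawaOToPowerSeries_coe_map] using key
  -- rigidity: `T ω⁺_{2m} ∣ ν w E − μt L⁻` for all `m`, and `⋂ (T ω⁺_{2m}) = 0`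
  rw [← sub_eq_zero]
  refine eq_zero_of_forall_dvd_of_map_eq_X_pow (O := padicCoeffIntegers (Set.range ι))
    (fun m : ℕ ↦ (((X * cyclotomicOmegaPlus p (2 * m)).map (Int.castRingHom (padicCoeffIntegers (Set.range ι))) :
      (padicCoeffIntegers (Set.range ι))[X]) : IwasawaAlgebraO (Set.range ι)))
    (fun m ↦ (X * cyclotomicOmegaPlus p (2 * m)).natDegree)
    (fun m ↦ map_residue_coe_eq_X_pow p (Polynomial.monic_X.mul (monic_cyclotomicOmegaPlus p _))
      (X_mul_cyclotomicOmegaPlus_dvd p _))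
    (fun k ↦ ⟨k, ?_⟩) (fun m ↦ ?_)
  · rw [Polynomial.monic_X.natDegree_mul (monic_cyclotomicOmegaPlus p _), Polynomial.natDegree_X]
    have := le_natDegree_cyclotomicOmegaPlus p k
    omega
  · exact dvd_sub_of_congr_powerSeries (S := Set.range ι) (hsign (2 * m)) (Polynomial.monic_X.mul (monic_cyclotomicOmegaPlus p _))
      (monic_cyclotomicOmegaMinus p _) (X_mul_cyclotomicOmegaPlus_mul_cyclotomicOmegaMinus p (2 * m)).symm
      (h₁ m) (h₂ m)

/-- **K-γ, Λ-multiplier form (PROVED).** If moreover `w` is a unit, the column is `L⁻_g` up to the multiplier: `C ν · E = μt · (L⁻ · w⁻¹)` — the H11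
shape `e (𝒸 z') = D·(L⁻·u)` with `D := μt`, `u := w⁻¹`, for the class `z' = ν•z`. [cite: Kato2004Asterisque, Thm. 12.5 (1) (p. 221)] -/
theorem C_mul_eq_mul_mul_inv_of_congruences [FiniteDimensional ℚ_[p] (padicCoeffField (Set.range ι))]
    {Lp Lm : IwasawaAlgebraO (Set.range ι)} (hL : IsPollackPairK g ι Ω Lp Lm)
    (E : IwasawaAlgebraO (Set.range ι)) (Q : ℕ → IwasawaAlgebraO (Set.range ι))
    (μt : IwasawaAlgebraO (Set.range ι)) (ν : padicCoeffIntegers (Set.range ι)) (w : (IwasawaAlgebraO (Set.range ι))ˣ)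
    (hcol : ∀ m : ℕ, (((cyclotomicOmega p (2 * m)).map (Int.castRingHom (padicCoeffIntegers (Set.range ι))) :
        (padicCoeffIntegers (Set.range ι))[X]) : IwasawaAlgebraO (Set.range ι)) ∣
      Q m + ((((-1) ^ m * cyclotomicOmegaMinus p (2 * m)).map (Int.castRingHom (padicCoeffIntegers (Set.range ι))) :
        (padicCoeffIntegers (Set.range ι))[X]) : IwasawaAlgebraO (Set.range ι)) * E)
    (hMT : ∀ m : ℕ, ∃ (k : ℕ) (q : IwasawaAlgebraO (Set.range ι)),
      PowerSeries.C ((p : PadicAlgCl p) ^ k) *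
          (iwasawaOToPowerSeries (Set.range ι) μt * (((mazurTateElementK g Ω p (2 * m)).map ι : (PadicAlgCl p)[X]) : PowerSeries (PadicAlgCl p)) -
            iwasawaOToPowerSeries (Set.range ι) (PowerSeries.C ν * (w : IwasawaAlgebraO (Set.range ι)) * Q m)) =
        (((cyclotomicOmega p (2 * m)).map (Int.castRingHom (PadicAlgCl p)) : (PadicAlgCl p)[X]) : PowerSeries (PadicAlgCl p)) *
          iwasawaOToPowerSeries (Set.range ι) q) :
    PowerSeries.C ν * E = μt * (Lm * ((w⁻¹ : (IwasawaAlgebraO (Set.range ι))ˣ) : IwasawaAlgebraO (Set.range ι))) := by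
  have H := C_mul_mul_eq_mul_of_congruences hL E Q μt ν (w : IwasawaAlgebraO (Set.range ι)) hcol hMT
  have h1 : PowerSeries.C ν * E = PowerSeries.C ν * (w : IwasawaAlgebraO (Set.range ι)) * E *
      ((w⁻¹ : (IwasawaAlgebraO (Set.range ι))ˣ) : IwasawaAlgebraO (Set.range ι)) := by
    rw [mul_right_comm (PowerSeries.C ν) (w : IwasawaAlgebraO (Set.range ι)) E, Units.mul_inv_cancel_right]
  rw [h1, H, mul_assoc]

end Relay

/-! ## §3 K-γ over the route's OWN pins: `π.hcol` through `e`, then K-β — the `hERL` input of the (i)-half price node, `D := μt` -/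

section Pins

open Literature.NumberTheory.EllipticCurves.GreenbergSelmer Literature.NumberTheory.GaloisRepresentations
  NumberField IsDedekindDomain Field Kobayashi2003 Rat.HeightOneSpectrum
  Summit.BirchSwinnertonDyer.BirchSwinnertonDyer.Theorems.OnePair

/-- `Λ = ℤ₂⟦X⟧ → Λ_𝒪` on (the power series of) an integer polynomial. [folklore] -/
theorem map_padicIntToCoeffIntegers_coe_map {p : ℕ} [Fact p.Prime] (S : Set (PadicAlgCl p)) (P : ℤ[X]) :
    PowerSeries.map (padicIntToCoeffIntegers S) ((P.map (Int.castRingHom ℤ_[p]) : ℤ_[p][X]) : PowerSeries ℤ_[p]) =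
      ((P.map (Int.castRingHom (padicCoeffIntegers S)) : (padicCoeffIntegers S)[X]) : IwasawaAlgebraO S) := by
  rw [← Polynomial.polynomial_map_coe, Polynomial.map_map,
    RingHom.ext_int ((padicIntToCoeffIntegers S).comp (Int.castRingHom ℤ_[p])) (Int.castRingHom _)]

variable {M : ℕ} {g : CuspForm (Gamma0 M) 2} {ι : coeffField g →+* PadicAlgCl 2} {Ω : ℂ}
  {W : WeierstrassCurve ℚ} [W.IsElliptic] {κ : ZpExtension ℚ 2} {γ : absoluteGaloisGroup ℚ}
  {S₀ : Finset (HeightOneSpectrum (𝓞 ℚ))} {n : ℕ} {ρ : FramedGaloisRep ℚ ↥(padicCoeffIntegers (Set.range ι)) 2}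
  {Θ : ∀ v : HeightOneSpectrum (𝓞 ℚ), ((2 : ℕ) : 𝓞 ℚ) ∈ v.asIdeal →
    (Cofree ρ ↥(padicCoeffField (Set.range ι)) ≃+ (Fin n → ↥(W.geomPrimaryTorsion 2)))}
  {hΘ : ∀ v hv (δ : absoluteGaloisGroup (v.adicCompletion ℚ)) m i,
    Θ v hv (resGalOfEmb (closureEmb (K := ℚ) (v.adicCompletion ℚ)) δ • m) i =
      resGalOfEmb (closureEmb (K := ℚ) (v.adicCompletion ℚ)) δ • Θ v hv m i}
  {I : Kato2004.IwasawaH1DataCoeff (FramedGaloisRep.toGaloisRep ρ) 2 κ γ}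
  {Sg : AddSubgroup (subgroupH1 κ.kerSubgroup (Cofree ρ ↥(padicCoeffField (Set.range ι))))}
  [Module ↥(padicCoeffIntegers (Set.range ι)) ↥Sg]

set_option maxHeartbeats 1600000 in
/-- **`hERL` from Mazur–Tate VALUES, Λ-multiplier form (PROVED modulo the values).** For the pinned one-pair data `π`, a class `z ∈ 𝐇¹_Γ(T_ρ)`, an
`𝒪`-Pollack pair `(L⁺, L⁻)` of `g`, and ANY additive `Λ`-semilinear `e : Λⁿ ≃ Λ_𝒪`: IF for every Honda datum `(gH, dH)` admitted by the pin `π.hcol`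
(all six conjuncts handed to the supplier) MTV_Λ holds — `μt·θ_{2m}(g)^ι ≡ ν·w·e(P⃗_{2m}(z)) (mod ω_{2m})` in `Λ_𝒪 ⊗ ℚ` (unfolded, power-series
left member) for all `m`, with a multiplier `μt ∈ Λ_𝒪 ∖ 0` (the auxiliary-`𝔞` twist of Kato's §15 class, (15.6.3)), a constant `ν ∈ 𝒪 ∖ 0` and a unit
`w` (`P⃗_{2m}(z)_i` = the pairing-sum polynomial of the coordinate functional `locd₂ z ∘ single i` against the `gH`-translates of `dH(2m)`, VERBATIM the
pin's) — THEN `C ν · e(𝒸 z) = D·(L⁻·u)` with `D = μt ≠ 0`, `u = w⁻¹ ≠ 0`: the `hERL` input of `PriceNode.price_of_parts` for the class `ν • z`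
(S3″'s `D` absorbs the multiplier). MTV_Λ is what Kato's Thm. 12.5 (1) (values of `exp*`, CM case §15.16) with (BK) and Kobayashi's Prop. 8.25 /
Lem. 8.26 per `Θ`-coordinate give; it is NOT proved here. [cite: Kato2004Asterisque, Thm. 12.5 (1) (p. 221), §15.16, (15.6.3) (p. 254)]
[cite: Kobayashi2003, Thm. 6.2, (8.23), Prop. 8.25 (pp. 18–23)] [cite: Pollack2003, Thm. 5.1, Prop. 6.18] -/
theorem hERL_of_mazurTateValues [FiniteDimensional ℚ_[2] (padicCoeffField (Set.range ι))]
    (π : OnePairPins (Set.range ι) W κ γ S₀ n ρ Θ hΘ I Sg) (z : I.H)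
    {Lp Lm : IwasawaAlgebraO (Set.range ι)} (hL : IsPollackPairK g ι Ω Lp Lm)
    (e : (Fin n → PowerSeries ℤ_[2]) ≃+ IwasawaAlgebraO (Set.range ι))
    (he : ∀ (r : PowerSeries ℤ_[2]) (t : Fin n → PowerSeries ℤ_[2]),
      e (r • t) = PowerSeries.map (padicIntToCoeffIntegers (Set.range ι)) r * e t)
    (hMT : ∀ (gH : absoluteGaloisGroup (π.v.adicCompletion ℚ)) (dH : ℕ → localPoints W (π.v.adicCompletion ℚ))
      (hdA : ∀ m j, gH ^ j • dH m ∈ Sprung2012.localTowerPointsOfEmb κ (closureEmb (K := ℚ) (π.v.adicCompletion ℚ)) W),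
      κ.IsTopGenerator (resGalOfEmb (closureEmb (K := ℚ) (π.v.adicCompletion ℚ)) gH) →
      (∀ m, dH m ∈ localLayerPointsOfEmb κ (closureEmb (K := ℚ) (π.v.adicCompletion ℚ)) W m) →
      (∀ m, localTraceOfEmb κ (closureEmb (K := ℚ) (π.v.adicCompletion ℚ)) W (m + 1) (m + 2) (dH (m + 2)) = -dH m) →
      (∀ b ∈ localLayerPointsOfEmb κ (closureEmb (K := ℚ) (π.v.adicCompletion ℚ)) W 0, dH 0 ≠ 2 • b) →
      (∀ (z' : ↥(Sprung2012.localTowerPointsOfEmb κ (closureEmb (K := ℚ) (π.v.adicCompletion ℚ)) W) →+ ℤ_[2]) (m : ℕ),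
        (((cyclotomicOmega 2 (2 * m)).map (Int.castRingHom ℤ_[2]) : Polynomial ℤ_[2]) : PowerSeries ℤ_[2]) ∣
          ((∑ j ∈ Finset.range (2 ^ (2 * m)), Polynomial.C (z' ⟨gH ^ j • dH (2 * m), hdA (2 * m) j⟩) * (Polynomial.X + 1) ^ j :
              Polynomial ℤ_[2]) : PowerSeries ℤ_[2]) +
            (-1 : PowerSeries ℤ_[2]) ^ m * (((cyclotomicOmegaMinus 2 (2 * m)).map (Int.castRingHom ℤ_[2]) : Polynomial ℤ_[2]) :
              PowerSeries ℤ_[2]) * π.col z') →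
      (∀ (z' : ↥(Sprung2012.localTowerPointsOfEmb κ (closureEmb (K := ℚ) (π.v.adicCompletion ℚ)) W) →+ ℤ_[2])
        (Lz : PowerSeries ℤ_[2]),
        (∀ m : ℕ, (((cyclotomicOmega 2 (2 * m)).map (Int.castRingHom ℤ_[2]) : Polynomial ℤ_[2]) : PowerSeries ℤ_[2]) ∣
          ((∑ j ∈ Finset.range (2 ^ (2 * m)), Polynomial.C (z' ⟨gH ^ j • dH (2 * m), hdA (2 * m) j⟩) * (Polynomial.X + 1) ^ j :
              Polynomial ℤ_[2]) : PowerSeries ℤ_[2]) +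
            (-1 : PowerSeries ℤ_[2]) ^ m * (((cyclotomicOmegaMinus 2 (2 * m)).map (Int.castRingHom ℤ_[2]) : Polynomial ℤ_[2]) :
              PowerSeries ℤ_[2]) * Lz) → Lz = π.col z') →
      ∃ (μt : IwasawaAlgebraO (Set.range ι)) (ν : padicCoeffIntegers (Set.range ι)) (w : IwasawaAlgebraO (Set.range ι)),
        μt ≠ 0 ∧ ν ≠ 0 ∧ IsUnit w ∧
        ∀ m : ℕ, ∃ (k : ℕ) (q : IwasawaAlgebraO (Set.range ι)),
          PowerSeries.C ((2 : PadicAlgCl 2) ^ k) *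
              (iwasawaOToPowerSeries (Set.range ι) μt *
                  (((mazurTateElementK g Ω 2 (2 * m)).map ι : (PadicAlgCl 2)[X]) : PowerSeries (PadicAlgCl 2)) -
                iwasawaOToPowerSeries (Set.range ι) (PowerSeries.C ν * w *
                  e (fun i => ((∑ j ∈ Finset.range (2 ^ (2 * m)),
                    Polynomial.C (((π.locd₂ z).comp (AddMonoidHom.single
                      (fun _ : Fin n => ↥(Sprung2012.localTowerPointsOfEmb κ (closureEmb (K := ℚ) (π.v.adicCompletion ℚ)) W)) i))
                      ⟨gH ^ j • dH (2 * m), hdA (2 * m) j⟩) * (Polynomial.X + 1) ^ j : Polynomial ℤ_[2]) : PowerSeries ℤ_[2])))) =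
            (((cyclotomicOmega 2 (2 * m)).map (Int.castRingHom (PadicAlgCl 2)) : (PadicAlgCl 2)[X]) : PowerSeries (PadicAlgCl 2)) *
              iwasawaOToPowerSeries (Set.range ι) q)
    : ∃ (ν : padicCoeffIntegers (Set.range ι)) (D u : IwasawaAlgebraO (Set.range ι)), ν ≠ 0 ∧ D ≠ 0 ∧ u ≠ 0 ∧
        PowerSeries.C ν * e (π.cvec z) = D * (Lm * u) := by
  obtain ⟨gH, dH, hdA, hgen, hlay, htr, hndiv, hcong, huniq⟩ := π.hcol
  obtain ⟨μt, ν, w, hμt, hν, ⟨wu, rfl⟩, hMTV⟩ := hMT gH dH hdA hgen hlay htr hndiv hcong huniq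
  -- (a) the pin's congruences, coordinate functional by coordinate functional, pushed through `e`
  have hcolO : ∀ m : ℕ, (((cyclotomicOmega 2 (2 * m)).map (Int.castRingHom (padicCoeffIntegers (Set.range ι))) :
        (padicCoeffIntegers (Set.range ι))[X]) : IwasawaAlgebraO (Set.range ι)) ∣
      e (fun i => ((∑ j ∈ Finset.range (2 ^ (2 * m)),
          Polynomial.C (((π.locd₂ z).comp (AddMonoidHom.single
            (fun _ : Fin n => ↥(Sprung2012.localTowerPointsOfEmb κ (closureEmb (K := ℚ) (π.v.adicCompletion ℚ)) W)) i))
            ⟨gH ^ j • dH (2 * m), hdA (2 * m) j⟩) * (Polynomial.X + 1) ^ j : Polynomial ℤ_[2]) : PowerSeries ℤ_[2])) +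
        ((((-1) ^ m * cyclotomicOmegaMinus 2 (2 * m)).map (Int.castRingHom (padicCoeffIntegers (Set.range ι))) :
          (padicCoeffIntegers (Set.range ι))[X]) : IwasawaAlgebraO (Set.range ι)) * e (π.cvec z) := by
    intro m
    choose b hb using fun i : Fin n => hcong ((π.locd₂ z).comp (AddMonoidHom.single
      (fun _ : Fin n => ↥(Sprung2012.localTowerPointsOfEmb κ (closureEmb (K := ℚ) (π.v.adicCompletion ℚ)) W)) i)) m
    refine ⟨e b, ?_⟩
    have hvec : (fun i => ((∑ j ∈ Finset.range (2 ^ (2 * m)),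
          Polynomial.C (((π.locd₂ z).comp (AddMonoidHom.single
            (fun _ : Fin n => ↥(Sprung2012.localTowerPointsOfEmb κ (closureEmb (K := ℚ) (π.v.adicCompletion ℚ)) W)) i))
            ⟨gH ^ j • dH (2 * m), hdA (2 * m) j⟩) * (Polynomial.X + 1) ^ j : Polynomial ℤ_[2]) : PowerSeries ℤ_[2])) +
        ((((-1) ^ m * cyclotomicOmegaMinus 2 (2 * m)).map (Int.castRingHom ℤ_[2]) : ℤ_[2][X]) : PowerSeries ℤ_[2]) • π.cvec z =
        (((cyclotomicOmega 2 (2 * m)).map (Int.castRingHom ℤ_[2]) : ℤ_[2][X]) : PowerSeries ℤ_[2]) • b := by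
      funext i
      simp only [Pi.add_apply, Pi.smul_apply, smul_eq_mul, OnePairPins.cvec_apply]
      rw [← hb i]
      simp only [Polynomial.map_mul, Polynomial.map_pow, Polynomial.map_neg, Polynomial.map_one, Polynomial.coe_mul,
        Polynomial.coe_pow, Polynomial.coe_neg, Polynomial.coe_one]
    have key := congr_arg e hvec
    rw [map_add, he, he, map_padicIntToCoeffIntegers_coe_map, map_padicIntToCoeffIntegers_coe_map] at key
    exact key
  -- (b)+(c): K-β / K-γ in Λ-multiplier form
  have H := C_mul_eq_mul_mul_inv_of_congruences hL (e (π.cvec z)) (fun m => e (fun i =>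
      ((∑ j ∈ Finset.range (2 ^ (2 * m)),
          Polynomial.C (((π.locd₂ z).comp (AddMonoidHom.single
            (fun _ : Fin n => ↥(Sprung2012.localTowerPointsOfEmb κ (closureEmb (K := ℚ) (π.v.adicCompletion ℚ)) W)) i))
            ⟨gH ^ j • dH (2 * m), hdA (2 * m) j⟩) * (Polynomial.X + 1) ^ j : Polynomial ℤ_[2]) : PowerSeries ℤ_[2])))
    μt ν wu hcolO hMTV
  exact ⟨ν, μt, ((wu⁻¹ : (IwasawaAlgebraO (Set.range ι))ˣ) : IwasawaAlgebraO (Set.range ι)), hν, hμt, Units.ne_zero _, H⟩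

end Pins

/-! ## §4 Frame lemma: two `A`-equivariant additive frames differ by multiplication by a constant (PROVED) -/

section Frame

variable {𝒪 R : Type*} [CommRing 𝒪] [CommRing R] {n : ℕ}

/-- **Two `A`-equivariant additive frames differ by an `𝒪`-linear map.** If `Φ : 𝒪 ≃+ Rⁿ` (the lattice frame of `PriceNode` LATTICE) and
`c : 𝒪 →+ Rⁿ` (the de Rham frame induced by `Θ` on `Fil⁰D_dR`) both intertwine multiplication by `a` with the matrix `A a`, then `Φ⁻¹ ∘ c` is
`𝒪`-linear. [cite: Kato2004Asterisque, §13.8 (p. 228)] -/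
theorem symm_frame_mul (A : 𝒪 → Matrix (Fin n) (Fin n) R) (Φ : 𝒪 ≃+ (Fin n → R)) (c : 𝒪 →+ (Fin n → R))
    (hΦ : ∀ a b : 𝒪, Φ (a * b) = (A a).mulVec (Φ b)) (hc : ∀ a b : 𝒪, c (a * b) = (A a).mulVec (c b)) (a b : 𝒪) :
    Φ.symm (c (a * b)) = a * Φ.symm (c b) := by
  apply Φ.injective
  rw [Φ.apply_symm_apply, hΦ, Φ.apply_symm_apply, hc]

/-- Hence `Φ⁻¹ ∘ c` is multiplication by the CONSTANT `β = Φ⁻¹(c 1) ∈ 𝒪`: the FRAME discrepancy between values read in the de Rham frame and the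
column read in the lattice frame is one constant of `𝒪` (the `ν` of MTV_Λ); the power-series multiplier `μt` is a property of the CLASS (auxiliary-`𝔞`
twist), not of the frames. [cite: Kato2004Asterisque, §13.8 (p. 228), (15.6.3) (p. 254)] -/
theorem symm_frame_eq_mul (A : 𝒪 → Matrix (Fin n) (Fin n) R) (Φ : 𝒪 ≃+ (Fin n → R)) (c : 𝒪 →+ (Fin n → R))
    (hΦ : ∀ a b : 𝒪, Φ (a * b) = (A a).mulVec (Φ b)) (hc : ∀ a b : 𝒪, c (a * b) = (A a).mulVec (c b)) (a : 𝒪) :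
    Φ.symm (c a) = a * Φ.symm (c 1) := by
  rw [← symm_frame_mul A Φ c hΦ hc a 1, mul_one]

end Frame

end Summit.BirchSwinnertonDyer.BirchSwinnertonDyer.Theorems.ThetaTransport.MazurTateValuesRelay

end
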